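import Literature.Geometry.Symplectic.OrigamiFoldCollar
import Literature.Geometry.Symplectic.OrigamiModelForm
import HarnessLib

/-!
# The collar form and the model form agree along the fold (zeroth-order normal form)

Eighth proofs companion of `OrigamiUnfolding.lean` (fact seat of
`Literature.Geometry.Symplectic.exists_symplecticCutPieces_of_isOrigamiForm`), step (S1)
(Cannas da Silva–Guillemin–Pires, *Symplectic Origami*, proof of Prop. 2.8; Cannas da Silva–
Guillemin–Woodward 2000, proof of Thm. 1: the Moser argument starts from "`ω` and
`ω₀ = p^*i^*ω + d(t² p^*α)` agree at the points of `Z`").  For a `2`-form `ω` on a 4-manifold,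
fold data `j : N → M`, a unit field `U` of a defining function whose vectors along the fold lie
in `ker ω` (`OrigamiFoldKernelField.lean`), the collar `c = foldCollar U j : N × ℝ → M`
(`OrigamiFoldCollar.lean`) and ANY smooth `1`-form `α` on `N`:

* `cam_two_prod_real_expand`, `cam_two_prod_real_ext` — a real `2`-form on `V × ℝ` is
  determined by its values on `((0,1), ·)` and on horizontal pairs;
* **`pullback_foldCollar_zero_eq_modelForm`** — at every point `(n, 0)` of the zero section,
  `(c^*ω)_{(n,0)} = (ω₀)_{(n,0)}` as `2`-forms on `T_{(n,0)}(N × ℝ)`, where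
  `ω₀ = p^*(j^*ω) + d(t² p^*α)` is the model form of `OrigamiModelForm.lean`: both kill
  `(0, 1)` (`pullback_foldCollar_apply_inr`, `modelForm_apply_zero_inr`) and both restrict to
  `j^*ω` (`pullback_foldCollar_apply_inl_inl`, `modelForm_apply_zero_inl_inl`).

No normalisation of the collar is needed for this zeroth-order agreement; it is what keeps the
Moser segment `(1-s) c^*ω + s ω₀` folded near the zero section.  Everything here is proved; no
definitions, no facts.

## References

* A. Cannas da Silva, V. Guillemin, A. R. Pires, *Symplectic Origami*, IMRN 2011 =
  arXiv:0909.4065, proof of Prop. 2.8. [CannasdasilvaGuilleminPires2010]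
* A. Cannas da Silva, V. Guillemin, C. Woodward, *On the unfolding of folded symplectic
  structures*, Math. Res. Lett. 7 (2000), proof of Thm. 1. [CannasGuilleminWoodward2000]
-/

noncomputable section

open scoped Manifold ContDiff Topology
open Set Function Filter
open Literature.Geometry.Kaehler Literature.Topology.FourManifolds

namespace Literature.Geometry.Symplectic

/-! ### Two-forms on `V × ℝ` are determined by `ι_{(0,1)}` and the horizontal part -/

section Algebra

variable {V : Type*} [NormedAddCommGroup V] [NormedSpace ℝ V]

/-- Swapping the two arguments of a real `2`-form changes the sign. [folklore] -/
private theorem alt_pair_swap (C : (V × ℝ) [⋀^Fin 2]→L[ℝ] ℝ) (x y : V × ℝ) :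
    C ![y, x] = -C ![x, y] := by
  have h := C.map_swap ![x, y] (i := 0) (j := 1) (by decide)
  have hsw : (![x, y] : Fin 2 → V × ℝ) ∘ Equiv.swap (0 : Fin 2) 1 = ![y, x] := by
    funext i
    fin_cases i <;> rfl
  rw [hsw] at h
  exact h

/-- Linearity of a real `2`-form in its first argument along `x + c • e`. [folklore] -/
private theorem alt_pair_add_smul_left (C : (V × ℝ) [⋀^Fin 2]→L[ℝ] ℝ) (x e y : V × ℝ) (c : ℝ) :
    C ![x + c • e, y] = C ![x, y] + c * C ![e, y] := by
  rw [C.vecCons_add ![y] x (c • e), C.vecCons_smul ![y] c e, smul_eq_mul]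

/-- **Expansion of a `2`-form on `V × ℝ`**:
`C((a,σ),(b,τ)) = C((a,0),(b,0)) - τ C((0,1),(a,0)) + σ C((0,1),(b,0))`. [folklore] -/
theorem cam_two_prod_real_expand (C : (V × ℝ) [⋀^Fin 2]→L[ℝ] ℝ) (a b : V) (σ τ : ℝ) :
    C ![(a, σ), (b, τ)] =
      C ![(a, (0 : ℝ)), (b, (0 : ℝ))] - τ * C ![((0 : V), (1 : ℝ)), (a, (0 : ℝ))] +
      σ * C ![((0 : V), (1 : ℝ)), (b, (0 : ℝ))] := by
  have hx : ((a, σ) : V × ℝ) = (a, (0 : ℝ)) + σ • ((0 : V), (1 : ℝ)) := by ext <;> simp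
  have hy : ((b, τ) : V × ℝ) = (b, (0 : ℝ)) + τ • ((0 : V), (1 : ℝ)) := by ext <;> simp
  have hee : C ![((0 : V), (1 : ℝ)), ((0 : V), (1 : ℝ))] = 0 :=
    C.map_eq_zero_of_eq ![((0 : V), (1 : ℝ)), ((0 : V), (1 : ℝ))] (i := 0) (j := 1) rfl (by decide)
  have h1 := alt_pair_add_smul_left C (a, (0 : ℝ)) ((0 : V), (1 : ℝ))
    ((b, (0 : ℝ)) + τ • ((0 : V), (1 : ℝ))) σ
  have h2 : C ![(a, (0 : ℝ)), (b, (0 : ℝ)) + τ • ((0 : V), (1 : ℝ))] =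
      C ![(a, (0 : ℝ)), (b, (0 : ℝ))] - τ * C ![((0 : V), (1 : ℝ)), (a, (0 : ℝ))] := by
    rw [alt_pair_swap C ((b, (0 : ℝ)) + τ • ((0 : V), (1 : ℝ))) (a, (0 : ℝ)),
      alt_pair_add_smul_left, alt_pair_swap C (a, (0 : ℝ)) (b, (0 : ℝ))]
    ring
  have h3 : C ![((0 : V), (1 : ℝ)), (b, (0 : ℝ)) + τ • ((0 : V), (1 : ℝ))] =
      C ![((0 : V), (1 : ℝ)), (b, (0 : ℝ))] := by
    rw [alt_pair_swap C ((b, (0 : ℝ)) + τ • ((0 : V), (1 : ℝ))) ((0 : V), (1 : ℝ)),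
      alt_pair_add_smul_left, hee, alt_pair_swap C ((0 : V), (1 : ℝ)) (b, (0 : ℝ))]
    ring
  rw [hx, hy, h1, h2, h3]

/-- **A real `2`-form on `V × ℝ` is determined by `ι_{(0,1)}` and its horizontal part.**
[folklore] -/
theorem cam_two_prod_real_ext {A B : (V × ℝ) [⋀^Fin 2]→L[ℝ] ℝ}
    (hinr : ∀ W : V × ℝ, A ![((0 : V), (1 : ℝ)), W] = B ![((0 : V), (1 : ℝ)), W])
    (hinl : ∀ v v' : V, A ![(v, (0 : ℝ)), (v', (0 : ℝ))] = B ![(v, (0 : ℝ)), (v', (0 : ℝ))]) :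
    A = B := by
  refine ContinuousAlternatingMap.ext fun x => ?_
  have hx : x = ![(((x 0).1, (x 0).2) : V × ℝ), (((x 1).1, (x 1).2) : V × ℝ)] := by
    funext i
    fin_cases i <;> rfl
  rw [hx, cam_two_prod_real_expand A, cam_two_prod_real_expand B, hinl, hinr, hinr]

end Algebra

/-! ### Agreement along the fold -/

universe u

variable {M : Type u} [TopologicalSpace M] [T2Space M] [CompactSpace M]
  [ChartedSpace (EuclideanSpace ℝ (Fin 4)) M] [IsManifold (𝓡 4) ∞ M]
variable {N : Type} [TopologicalSpace N] [ChartedSpace (EuclideanSpace ℝ (Fin 3)) N]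
  [IsManifold (𝓡 3) ∞ N]
variable {f : M → ℝ} (U : LevelUnitField 3 f 0) {j : N → M} {s : MForm (𝓡 4) M ℝ 2}

/-- **The collar form and the model form agree along the fold.**  For a unit field `U` whose
vectors along the fold lie in `ker ω` and any smooth `1`-form `α` on `N`, at every point
`(n, 0)` of the zero section the pulled-back form `c^*ω` of the collar `c = foldCollar U j`
coincides, as a `2`-form on `T_{(n,0)}(N × ℝ)`, with the model form
`ω₀ = p^*(j^*ω) + d(t² p^*α)`: both kill `(0, 1)` and both restrict to `j^*ω` on horizontal
pairs.  This is the starting point "`ω|_Z = ω₀|_Z`" of the Moser argument.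
[cite: CannasGuilleminWoodward2000, proof of Thm. 1] -/
theorem pullback_foldCollar_zero_eq_modelForm (hj : ContMDiff (𝓡 3) (𝓡 4) ∞ j)
    (hU : ∀ n, ∀ w : TangentSpace (𝓡 4) (j n), s (j n) ![U.ξ (j n), w] = 0)
    {α : MForm (𝓡 3) N ℝ 1} (hα : IsSmoothForm α) (n : N) :
    (s.pullback ((𝓡 3).prod 𝓘(ℝ, ℝ)) (foldCollar U j)) (n, 0) =
      ((s.pullback (𝓡 3) j).pullback ((𝓡 3).prod 𝓘(ℝ, ℝ)) (Prod.fst : N × ℝ → N) +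
        mextDeriv ((fun q : N × ℝ => q.2 ^ 2) •
          α.pullback ((𝓡 3).prod 𝓘(ℝ, ℝ)) (Prod.fst : N × ℝ → N))) (n, 0) := by
  refine cam_two_prod_real_ext (fun W => ?_) (fun v v' => ?_)
  · exact (pullback_foldCollar_apply_inr U hj hU n W).trans
      (modelForm_apply_zero_inr (s.pullback (𝓡 3) j) hα n W.1 W.2).symm
  · exact (pullback_foldCollar_apply_inl_inl U hj n v v').trans
      (modelForm_apply_zero_inl_inl (s.pullback (𝓡 3) j) hα n v v').symm

end Literature.Geometry.Symplectic

end
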